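import Literature.Analysis.FluidPDE.PassiveScalarEnergyPointwise
import Literature.Analysis.FluidPDE.PassiveScalarUniquenessL1Sobolev
import Summits.AnomalousDissipation.AnomalousDissipation.Theorems.TwoAndHalfDSourcedScalarUnique2DDifference

/-!
# Route LimitingAbsorption (AnomalousDissipation) — weak-class toolkit for
`KinematicSteadySourceLaw` (stmt-AnomalousDissipation-2938)

Helper lemmas (supports) for the relaxation clause `(U_h)` of
`Summit.AnomalousDissipation.AnomalousDissipation.Theses.LimitingAbsorption.KinematicSteadySourceLaw`
and for `…LimitingAbsorption.RelaxationBoundsInventory` (stmt-2940), in the weak class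
`Torus.IsWeakScalarTransportOn` / `Torus.IsWeakScalarTransportForcedOn` of the tree:

* `ae_eq_of_memLp_top` — **uniqueness for bounded drift**: for `κ > 0` and a velocity field
  `u ∈ L^∞((0,T) × T^d)`, two weak solutions in `L^∞_t L²_x` with the same datum agree for a.e.
  `t` (the difference solves the homogeneous problem from datum `0`,
  `IsWeakScalarTransportOn.sub_of_eq_datum`, and the pointwise energy inequality
  `IsWeakScalarTransportOn.lintegral_sq_add_le_holds` kills it; no integrability of the datum and
  no Sobolev regularity of the drift are needed);
* `forced_ae_eq_of_memLp_top` — the same for the sourced equation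
  (`isWeakScalarTransportOn_sub`);
* `ae_scalarL2Sq_le` — **`L²` contraction**: `‖θ(t)‖²_{L²} ≤ ‖θ₀‖²_{L²}` for a.e. `t`, in the
  `Torus.scalarL2Sq` currency of the route file;
* `congr_velocity`, `forced_congr_velocity` — the weak notions only see the drift on `(0,T)`;
* `periodic_intPhase`, `isWeakScalarTransportOn_intPhase_iff` — for a field `1`-periodic on
  `t ≥ 0`, the phase-`n` problem (drift `v (n + ·)`) has the same weak solutions as the phase-`0`
  problem, so a phase-`0` relaxation estimate (e.g. the named fact
  `Literature.Analysis.FluidPDE.HessChildsRowan2025_cor12`) transfers to all integer phases.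

## References

* R. J. DiPerna, P.-L. Lions, Invent. Math. 98 (1989), §II.1–II.3. [`DiPernaLions1989`]
* T. Drivas, T. Elgindi, G. Iyer, I.-J. Jeong, ARMA 243 (2022), (1.3). [`DEIJ2022`]
-/

noncomputable section

open MeasureTheory Set Filter Function TopologicalSpace
open scoped ENNReal NNReal InnerProductSpace

namespace Summit.AnomalousDissipation.AnomalousDissipation.Theorems.KinematicSteadySourceLaw

-- D-0017: single-problem summit ⇒ `Summit.AnomalousDissipation.AnomalousDissipation.…` by design.
set_option linter.dupNamespace false

open Literature.Analysis Literature.Analysis.FluidPDE Literature.Analysis.FluidPDE.Torus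

variable {d : Type*} [Fintype d]

/-! ## `L²` bookkeeping -/

/-- `‖f‖²_{L²}` in the `scalarL2Sq` currency is the real part of the finite `lintegral`
`∫⁻ ‖f‖ₑ²` for `f ∈ L²(T^d)`: `scalarL2Sq f = (∫⁻ ‖f‖ₑ²).toReal` and `∫⁻ ‖f‖ₑ² < ∞`. [folklore] -/
theorem scalarL2Sq_eq_toReal_lintegral_and_lt_top {f : UnitAddTorus d → ℝ} (hf : MemLp f 2 volume) :
    scalarL2Sq f = (∫⁻ x, ‖f x‖ₑ ^ 2).toReal ∧ ∫⁻ x, ‖f x‖ₑ ^ 2 < ⊤ := by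
  constructor
  · change ∫ x, f x ^ 2 = _
    rw [integral_eq_lintegral_of_nonneg_ae (Eventually.of_forall fun x => sq_nonneg (f x))
      (hf.integrable_sq.aestronglyMeasurable)]
    congr 1
    refine lintegral_congr fun x => ?_
    rw [Real.enorm_eq_ofReal_abs, ← ENNReal.ofReal_pow (abs_nonneg _), sq_abs]
  · rw [← PassiveScalarProofs.eLpNorm_two_pow_two]
    exact ENNReal.pow_lt_top hf.eLpNorm_lt_top

/-! ## Uniqueness and `L²` contraction for bounded drift -/

section Unforced

variable {T κ : ℝ} {u : ℝ → UnitAddTorus d → EuclideanSpace ℝ d} {θ₀ : UnitAddTorus d → ℝ}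
  {θ θ₁ θ₂ : ℝ → UnitAddTorus d → ℝ}

/-- **Uniqueness for bounded drift.** For `κ > 0` and `u ∈ L^∞((0,T) × T^d)`, two weak solutions
of `∂ₜθ + u·∇θ = κΔθ` in `L^∞_t L²_x` with the same datum coincide for a.e. `t ∈ (0,T)`: their
difference is a weak solution from datum `0` (`sub_of_eq_datum`) and the pointwise energy
inequality for bounded drift (`lintegral_sq_add_le_holds`) gives `∫ |θ₁(t) - θ₂(t)|² ≤ 0`
(DEIJ 2022, (1.3); Le Bris–Lions 2008 / Figalli 2008 for the general Fokker–Planck statement).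
[cite: DEIJ2022, (1.3)] -/
theorem ae_eq_of_memLp_top (hκ : 0 < κ)
    (h₁ : IsWeakScalarTransportOn T κ u θ₀ θ₁) (h₂ : IsWeakScalarTransportOn T κ u θ₀ θ₂)
    (hu : MemLp (FunctionSpaces.Torus.stLift u) ∞ (volume.restrict (Ioo 0 T ×ˢ univ))) :
    ∀ᵐ t ∂(volume.restrict (Ioo 0 T)), θ₁ t =ᵐ[volume] θ₂ t := by
  have hd := h₁.sub_of_eq_datum h₂
  have hE := IsWeakScalarTransportOn.lintegral_sq_add_le_holds hκ hd MemLp.zero hu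
  filter_upwards [hE, hd.ae_aestronglyMeasurable_slice] with t ht hm
  have hrhs : ∫⁻ x, ‖(0 : UnitAddTorus d → ℝ) x‖ₑ ^ 2 = 0 := by simp
  have h0 : ∫⁻ x, ‖θ₁ t x - θ₂ t x‖ₑ ^ 2 = 0 :=
    le_antisymm ((le_self_add.trans ht).trans hrhs.le) zero_le
  have hae : ∀ᵐ x ∂volume, ‖θ₁ t x - θ₂ t x‖ₑ ^ 2 = 0 :=
    (lintegral_eq_zero_iff' (hm.enorm.pow_const 2)).1 h0
  filter_upwards [hae] with x hx
  have hx' : ‖θ₁ t x - θ₂ t x‖ₑ = 0 := by simpa using hx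
  rwa [enorm_eq_zero, sub_eq_zero] at hx'

/-- **`L²` contraction for bounded drift**, in the `scalarL2Sq` currency: for `κ > 0`,
`u ∈ L^∞((0,T) × T^d)` and `θ₀ ∈ L²`, every weak solution obeys `‖θ(t)‖²_{L²} ≤ ‖θ₀‖²_{L²}`
for a.e. `t ∈ (0,T)` (drop the dissipation in `lintegral_sq_add_le_holds`; DEIJ 2022, (1.3)).
[cite: DEIJ2022, (1.3)] -/
theorem ae_scalarL2Sq_le (hκ : 0 < κ) (h : IsWeakScalarTransportOn T κ u θ₀ θ)
    (hθ₀ : MemLp θ₀ 2 volume)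
    (hu : MemLp (FunctionSpaces.Torus.stLift u) ∞ (volume.restrict (Ioo 0 T ×ˢ univ))) :
    ∀ᵐ t ∂(volume.restrict (Ioo 0 T)), scalarL2Sq (θ t) ≤ scalarL2Sq θ₀ := by
  have hE := IsWeakScalarTransportOn.lintegral_sq_add_le_holds hκ h hθ₀ hu
  filter_upwards [hE, h.ae_memLp_two] with t ht hm
  have hle : ∫⁻ x, ‖θ t x‖ₑ ^ 2 ≤ ∫⁻ x, ‖θ₀ x‖ₑ ^ 2 := le_self_add.trans ht
  calc scalarL2Sq (θ t) = (∫⁻ x, ‖θ t x‖ₑ ^ 2).toReal :=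
        (scalarL2Sq_eq_toReal_lintegral_and_lt_top hm).1
    _ ≤ (∫⁻ x, ‖θ₀ x‖ₑ ^ 2).toReal :=
        ENNReal.toReal_mono (scalarL2Sq_eq_toReal_lintegral_and_lt_top hθ₀).2.ne hle
    _ = scalarL2Sq θ₀ := (scalarL2Sq_eq_toReal_lintegral_and_lt_top hθ₀).1.symm

/-- **The weak notion only sees the drift on `(0,T)`**: replacing `u` by a field `u'` that agrees
with it at every `t ∈ (0,T)` preserves weak solutions (all conjuncts of
`Torus.IsWeakScalarTransportOn` are integrals over, or a.e. statements on, `(0,T)`). [folklore] -/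
theorem congr_velocity {u' : ℝ → UnitAddTorus d → EuclideanSpace ℝ d}
    (huu' : ∀ t ∈ Ioo 0 T, u' t = u t) (h : IsWeakScalarTransportOn T κ u θ₀ θ) :
    IsWeakScalarTransportOn T κ u' θ₀ θ where
  aestronglyMeasurable := h.aestronglyMeasurable
  aestronglyMeasurable_velocity := by
    refine h.aestronglyMeasurable_velocity.congr ?_
    filter_upwards [ae_restrict_mem (measurableSet_Ioo.prod MeasurableSet.univ)] with p hp
    obtain ⟨t, y⟩ := p
    simp only [FunctionSpaces.Torus.stLift_apply, huu' t (mem_prod.1 hp).1]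
  ae_lintegral_sq_le := h.ae_lintegral_sq_le
  lintegral_velocity_lt_top := by
    rw [setLIntegral_congr_fun measurableSet_Ioo
      (fun t ht => show (∫⁻ x, ‖u' t x‖ₑ ^ 2) ^ (1 / 2 : ℝ) = (∫⁻ x, ‖u t x‖ₑ ^ 2) ^ (1 / 2 : ℝ) by
        rw [huu' t ht])]
    exact h.lintegral_velocity_lt_top
  lintegral_mul_lt_top := by
    rw [setLIntegral_congr_fun measurableSet_Ioo
      (fun t ht => show ∫⁻ x, ‖u' t x‖ₑ * ‖θ t x‖ₑ = ∫⁻ x, ‖u t x‖ₑ * ‖θ t x‖ₑ by rw [huu' t ht])]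
    exact h.lintegral_mul_lt_top
  ae_isWeaklyDivFree := by
    filter_upwards [h.ae_isWeaklyDivFree, ae_restrict_mem measurableSet_Ioo] with t ht ht'
    rw [huu' t ht']
    exact ht
  weak_eq ψ hψ := by
    rw [setIntegral_congr_fun measurableSet_Ioo
      (fun t ht => show (∫ x, θ t x * (FunctionSpaces.Torus.timeDeriv ψ t x +
          ⟪u' t x, FunctionSpaces.Torus.gradient (ψ t) x⟫_ℝ +
          κ * FunctionSpaces.Torus.laplacian (ψ t) x)) =
        ∫ x, θ t x * (FunctionSpaces.Torus.timeDeriv ψ t x +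
          ⟪u t x, FunctionSpaces.Torus.gradient (ψ t) x⟫_ℝ +
          κ * FunctionSpaces.Torus.laplacian (ψ t) x) by rw [huu' t ht])]
    exact h.weak_eq ψ hψ

end Unforced

/-! ## The sourced equation -/

section Forced

variable {T κ : ℝ} {u : ℝ → UnitAddTorus d → EuclideanSpace ℝ d} {s : ℝ → UnitAddTorus d → ℝ}
  {θ₀ : UnitAddTorus d → ℝ} {θ θ₁ θ₂ : ℝ → UnitAddTorus d → ℝ}

/-- **Uniqueness for bounded drift, sourced equation.** For `κ > 0` and `u ∈ L^∞((0,T) × T^d)`,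
two weak solutions of `∂ₜθ + u·∇θ = κΔθ + s` in `L^∞_t L²_x` with the same datum and source
coincide for a.e. `t ∈ (0,T)` (their difference solves the homogeneous problem from datum `0`,
`isWeakScalarTransportOn_sub`; then as in `ae_eq_of_memLp_top`). [cite: DEIJ2022, (1.3)] -/
theorem forced_ae_eq_of_memLp_top (hκ : 0 < κ)
    (h₁ : IsWeakScalarTransportForcedOn T κ u s θ₀ θ₁) (h₂ : IsWeakScalarTransportForcedOn T κ u s θ₀ θ₂)
    (hu : MemLp (FunctionSpaces.Torus.stLift u) ∞ (volume.restrict (Ioo 0 T ×ˢ univ))) :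
    ∀ᵐ t ∂(volume.restrict (Ioo 0 T)), θ₁ t =ᵐ[volume] θ₂ t := by
  have hd := isWeakScalarTransportOn_sub h₁ h₂
  have hE := IsWeakScalarTransportOn.lintegral_sq_add_le_holds hκ hd MemLp.zero hu
  filter_upwards [hE, hd.ae_aestronglyMeasurable_slice] with t ht hm
  have hrhs : ∫⁻ x, ‖(0 : UnitAddTorus d → ℝ) x‖ₑ ^ 2 = 0 := by simp
  have h0 : ∫⁻ x, ‖θ₁ t x - θ₂ t x‖ₑ ^ 2 = 0 :=
    le_antisymm ((le_self_add.trans ht).trans hrhs.le) zero_le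
  have hae : ∀ᵐ x ∂volume, ‖θ₁ t x - θ₂ t x‖ₑ ^ 2 = 0 :=
    (lintegral_eq_zero_iff' (hm.enorm.pow_const 2)).1 h0
  filter_upwards [hae] with x hx
  have hx' : ‖θ₁ t x - θ₂ t x‖ₑ = 0 := by simpa using hx
  rwa [enorm_eq_zero, sub_eq_zero] at hx'

/-- **The sourced weak notion only sees the drift on `(0,T)`** (as `congr_velocity`). [folklore] -/
theorem forced_congr_velocity {u' : ℝ → UnitAddTorus d → EuclideanSpace ℝ d}
    (huu' : ∀ t ∈ Ioo 0 T, u' t = u t) (h : IsWeakScalarTransportForcedOn T κ u s θ₀ θ) :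
    IsWeakScalarTransportForcedOn T κ u' s θ₀ θ where
  aestronglyMeasurable := h.aestronglyMeasurable
  aestronglyMeasurable_velocity := by
    refine h.aestronglyMeasurable_velocity.congr ?_
    filter_upwards [ae_restrict_mem (measurableSet_Ioo.prod MeasurableSet.univ)] with p hp
    obtain ⟨t, y⟩ := p
    simp only [FunctionSpaces.Torus.stLift_apply, huu' t (mem_prod.1 hp).1]
  aestronglyMeasurable_source := h.aestronglyMeasurable_source
  ae_lintegral_sq_le := h.ae_lintegral_sq_le
  lintegral_velocity_lt_top := by
    rw [setLIntegral_congr_fun measurableSet_Ioo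
      (fun t ht => show (∫⁻ x, ‖u' t x‖ₑ ^ 2) ^ (1 / 2 : ℝ) = (∫⁻ x, ‖u t x‖ₑ ^ 2) ^ (1 / 2 : ℝ) by
        rw [huu' t ht])]
    exact h.lintegral_velocity_lt_top
  lintegral_mul_lt_top := by
    rw [setLIntegral_congr_fun measurableSet_Ioo
      (fun t ht => show ∫⁻ x, ‖u' t x‖ₑ * ‖θ t x‖ₑ = ∫⁻ x, ‖u t x‖ₑ * ‖θ t x‖ₑ by rw [huu' t ht])]
    exact h.lintegral_mul_lt_top
  lintegral_source_lt_top := h.lintegral_source_lt_top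
  ae_isWeaklyDivFree := by
    filter_upwards [h.ae_isWeaklyDivFree, ae_restrict_mem measurableSet_Ioo] with t ht ht'
    rw [huu' t ht']
    exact ht
  weak_eq ψ hψ := by
    rw [setIntegral_congr_fun measurableSet_Ioo
      (fun t ht => show (∫ x, θ t x * (FunctionSpaces.Torus.timeDeriv ψ t x +
          ⟪u' t x, FunctionSpaces.Torus.gradient (ψ t) x⟫_ℝ +
          κ * FunctionSpaces.Torus.laplacian (ψ t) x)) =
        ∫ x, θ t x * (FunctionSpaces.Torus.timeDeriv ψ t x +
          ⟪u t x, FunctionSpaces.Torus.gradient (ψ t) x⟫_ℝ +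
          κ * FunctionSpaces.Torus.laplacian (ψ t) x) by rw [huu' t ht])]
    exact h.weak_eq ψ hψ

end Forced

/-! ## Integer phases of a time-periodic drift -/

section Periodic

variable {T κ : ℝ} {v : ℝ → UnitAddTorus d → EuclideanSpace ℝ d} {θ₀ : UnitAddTorus d → ℝ}
  {θ : ℝ → UnitAddTorus d → ℝ} {s : ℝ → UnitAddTorus d → ℝ}

omit [Fintype d] in
/-- A field `1`-periodic on `t ≥ 0` is `n`-periodic there for every `n : ℕ`. [folklore] -/
theorem periodic_intPhase (hper : ∀ t : ℝ, 0 ≤ t → v (t + 1) = v t) (n : ℕ) {t : ℝ}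
    (ht : 0 ≤ t) : v (n + t) = v t := by
  induction n generalizing t with
  | zero => simp
  | succ n ih =>
    have e : ((n + 1 : ℕ) : ℝ) + t = n + (t + 1) := by push_cast; ring
    rw [e, ih (by linarith), hper t ht]

/-- **Integer phases see the same weak solutions**: for a drift `1`-periodic on `t ≥ 0`, the
phase-`n` problem (drift `t ↦ v (n + t)`) and the phase-`0` problem have the same weak solutions
on `[0,T)` for every datum (`congr_velocity` + `periodic_intPhase`). Hence a phase-`0` relaxation
estimate quantified over all weak solutions holds verbatim from every integer phase. [folklore] -/
theorem isWeakScalarTransportOn_intPhase_iff (hper : ∀ t : ℝ, 0 ≤ t → v (t + 1) = v t) (n : ℕ) :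
    IsWeakScalarTransportOn T κ (fun t => v (n + t)) θ₀ θ ↔ IsWeakScalarTransportOn T κ v θ₀ θ :=
  ⟨fun h => congr_velocity (fun _ ht => (periodic_intPhase hper n ht.1.le).symm) h,
    fun h => congr_velocity (fun _ ht => periodic_intPhase hper n ht.1.le) h⟩

/-- Sourced version of `isWeakScalarTransportOn_intPhase_iff`. [folklore] -/
theorem isWeakScalarTransportForcedOn_intPhase_iff (hper : ∀ t : ℝ, 0 ≤ t → v (t + 1) = v t)
    (n : ℕ) :
    IsWeakScalarTransportForcedOn T κ (fun t => v (n + t)) s θ₀ θ ↔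
      IsWeakScalarTransportForcedOn T κ v s θ₀ θ :=
  ⟨fun h => forced_congr_velocity (fun _ ht => (periodic_intPhase hper n ht.1.le).symm) h,
    fun h => forced_congr_velocity (fun _ ht => periodic_intPhase hper n ht.1.le) h⟩

end Periodic

/-! ## Uniformising an accelerating relaxation rate -/

section Uniformize

/-- **From an accelerating rate to a `κ`-uniform one.** If a quantity `f` (think
`‖θ^κ(t)‖²_{L²}`) obeys the contraction bound `f ≤ E` and an accelerating bound of the shape of
Hess-Childs–Rowan 2025, Cor. 1.2, `f ≤ (C₀ e^{-C₀⁻¹ log(κ⁻¹) (t-1)})² E`, then for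
`0 < κ ≤ κ₀ < 1` it obeys, at every time `t`, the `κ`-free exponential bound
`f ≤ max(C₀², 1) e^{2γ} e^{-2γ t} E` with `γ = C₀⁻¹ log κ₀⁻¹ > 0` (use the contraction for
`t < 1` and monotonicity of the rate in `κ` for `t ≥ 1`). This is the bookkeeping turning a
phase-`0` estimate of that shape into the `(C, γ)` form of the relaxation clause `(U_h)` of
`…LimitingAbsorption.KinematicSteadySourceLaw`, uniformly in `κ ≤ κ₀`. [folklore] -/
theorem decay_uniformize {C₀ κ κ₀ t f E : ℝ} (hC₀ : 0 < C₀) (hκ : 0 < κ) (hκκ₀ : κ ≤ κ₀)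
    (hκ₀ : κ₀ < 1) (hE : 0 ≤ E) (hcontr : f ≤ E)
    (hdecay : f ≤ (C₀ * Real.exp (-(C₀⁻¹ * Real.log κ⁻¹ * (t - 1)))) ^ 2 * E) :
    f ≤ max (C₀ ^ 2) 1 * Real.exp (2 * (C₀⁻¹ * Real.log κ₀⁻¹)) *
      Real.exp (-(2 * (C₀⁻¹ * Real.log κ₀⁻¹) * t)) * E := by
  set γ := C₀⁻¹ * Real.log κ₀⁻¹ with hγ
  set γκ := C₀⁻¹ * Real.log κ⁻¹ with hγκ
  have hκ₀pos : 0 < κ₀ := hκ.trans_le hκκ₀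
  have hγpos : 0 < γ := mul_pos (inv_pos.2 hC₀) (Real.log_pos (one_lt_inv₀ hκ₀pos |>.2 hκ₀))
  have hγle : γ ≤ γκ :=
    mul_le_mul_of_nonneg_left
      (Real.log_le_log (inv_pos.2 hκ₀pos) ((inv_le_inv₀ hκ₀pos hκ).2 hκκ₀)) (inv_nonneg.2 hC₀.le)
  have hM : max (C₀ ^ 2) 1 * Real.exp (2 * γ) * Real.exp (-(2 * γ * t)) =
      max (C₀ ^ 2) 1 * Real.exp (2 * γ * (1 - t)) := by
    rw [mul_assoc, ← Real.exp_add]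
    ring_nf
  rw [hM]
  rcases le_or_gt 1 t with h1t | ht1
  · -- `t ≥ 1`: the accelerating bound, with the rate at `κ₀`
    have hsq : (C₀ * Real.exp (-(γκ * (t - 1)))) ^ 2 = C₀ ^ 2 * Real.exp (2 * (-(γκ * (t - 1)))) := by
      rw [mul_pow, ← Real.exp_nat_mul]
      push_cast
      ring_nf
    calc f ≤ (C₀ * Real.exp (-(γκ * (t - 1)))) ^ 2 * E := hdecay
      _ = C₀ ^ 2 * Real.exp (2 * (-(γκ * (t - 1)))) * E := by rw [hsq]
      _ ≤ C₀ ^ 2 * Real.exp (2 * γ * (1 - t)) * E := by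
          have hexp : Real.exp (2 * (-(γκ * (t - 1)))) ≤ Real.exp (2 * γ * (1 - t)) := by
            rw [Real.exp_le_exp]
            have : γ * (t - 1) ≤ γκ * (t - 1) := mul_le_mul_of_nonneg_right hγle (by linarith)
            linarith
          have hC₀sq : 0 ≤ C₀ ^ 2 := sq_nonneg _
          exact mul_le_mul_of_nonneg_right (mul_le_mul_of_nonneg_left hexp hC₀sq) hE
      _ ≤ max (C₀ ^ 2) 1 * Real.exp (2 * γ * (1 - t)) * E := by
          have := le_max_left (C₀ ^ 2) 1
          gcongr
  · -- `t < 1`: the contraction bound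
    have hone : 1 ≤ max (C₀ ^ 2) 1 * Real.exp (2 * γ * (1 - t)) := by
      have h1 : (1 : ℝ) ≤ max (C₀ ^ 2) 1 := le_max_right _ _
      have h2 : (1 : ℝ) ≤ Real.exp (2 * γ * (1 - t)) :=
        Real.one_le_exp (by nlinarith)
      nlinarith
    calc f ≤ E := hcontr
      _ = 1 * E := (one_mul E).symm
      _ ≤ max (C₀ ^ 2) 1 * Real.exp (2 * γ * (1 - t)) * E := mul_le_mul_of_nonneg_right hone hE

end Uniformize

end Summit.AnomalousDissipation.AnomalousDissipation.Theorems.KinematicSteadySourceLaw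

end
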